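import Literature.AlgebraicGeometry.GroupSchemes.BTGroupNilpotentPoints     -- ★ p844872: `specOver`, the points currency (brings ★ `NilpotentEvaluation`, `BTGroup`)
import Literature.RingTheory.FormalGroups.NilpotentEvaluationPair          -- ★ p844734 (β) part 1: `evalNilp₂` ring identities
import Literature.RingTheory.FormalGroups.NilpotentPointsSeparation         -- ★ p844767 (β) part 3: universal points of `k⟦X⟧⧸(X^N)`, `k⟦X,Y⟧⧸(X^N,Y^N)`, separation
import HarnessLib

/-!
# Laws from coordinates: a group object over `Spec k` whose points are naturally `{x ∣ x^N = 0}` multiplies, and its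
# endomorphisms act, through power series — Yoneda with the universal nilpotent points ([Tate 1967] §2.2, proof of Prop. 1)

Topic `Literature/AlgebraicGeometry/GroupSchemes`; namespace `Literature.AlgebraicGeometry.GroupSchemes`.  THEOREMS ONLY (no
definition, no named fact, no instance, no notation, no `sorry`).  Cell `hodgecm-mathlib`, P6 «MOD programme», sub-desk F0P6d,
sub-line 2 `Cruxes/HLiu418/Lines/F0_P6d_ConnectedBTDictionary.lean`, letter (HL-D) `ConnectedDimOneIsOModuleLaw` — LEAD HAND σ1
plan (14:5xZ) step (P1): once the layers of a `p`-divisible group carry NATURAL NILPOTENT COORDINATES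
`c R : (Spec R → G over Spec k) ≃ {x ∈ R ∣ x^N = 0}` (the scheme-side step (S); ★ `MonogenicTowerCoordinates` p844858 + ★
`TruncatedPolynomialNilpotentPoints` p844916 give them from `IsConnectedDimOne`), the group law and every endomorphism of `G` ACT ON
POINTS THROUGH POWER SERIES — read off at the universal points `X̄` of `k⟦X⟧⧸(X^N)` and `(X̄₀, X̄₁)` of `k⟦X,Y⟧⧸(X^N, Y^N)` and
transported to any point by the algebra map `h ↦ h(r)` (★ (β) engine) and naturality.  No Hopf algebra, no tensor product, no
`Γ`.  HC_CM is proved only modulo the printed citations until rung 0 closes; nothing here is about HC.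

THE PRINT.  [Tate1967] §2.2, proof of Prop. 1: in compatible coordinates on the layers `G_ν = Spec A_ν` of a connected `p`-divisible
group, the comultiplications are truncated power series defining the formal Lie group in the limit.  Here, the FUNCTOR-OF-POINTS form
of «the comultiplication is a truncated series»: for ONE layer (indeed any group object `G` over `Spec k` with such coordinates) the
product of two `R`-points has coordinate `P(x, y)` for a fixed `P ∈ k⟦X,Y⟧`, and `f ≫ u` has coordinate `ρ_u(x)` for a fixed
`ρ_u ∈ k⟦X⟧` — both well defined below the box `N` (★ separation) and compatible along homomorphisms `G → G′` respecting coordinates.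

MAIN STATEMENTS.  §1 `exists_specOver_hom` (`Spec θ` as a morphism `specOver R′ ⟶ specOver R` over `Spec k`); §2
`exists_algHom_powerSeriesQuot` ∕ `exists_algHom_mvPowerSeriesQuot` (LIFTS `k⟦X⟧⧸(X^N) → R`, `X̄ ↦ r`, `h̄ ↦ h(r)` for `r^N = 0`,
resp. two variables, assembled from ★ `evalNilp`∕`evalNilp₂`'s ring identities); §3 `exists_comp_eq_of_coord_eq` (transport of
points), **`exists_series_of_endomorphism`** (`c (f ≫ u) = ρ_u (c f)`), **`exists_series_of_mul`** (`c (f * f′) = P (c f, c f′)`),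
**`coord_one_eq_zero`** (`c 1 = 0` over reduced `k`), **`coeff_law_eq_of_hom`** ∕ **`coeff_endo_eq_of_hom`** (law ∕ endomorphism
series are unique below the box and compatible along coordinate-respecting homomorphisms — the box-compatibility of the tower fed
to ★ `FormalGroupOfTruncatedLaws` ∕ ★ `FormalOModuleLawOfBuds`).

## References
* [Tate1967] J. T. Tate, *p-divisible groups*, Proc. Conf. Local Fields (Driebergen, 1966), Springer (1967) — §2.2, proof of Prop. 1.
* [BourbakiAlgebraII2003] N. Bourbaki, *Algebra II*, Ch. IV §4 no. 3 (substitution ∕ evaluation of formal power series at nilpotent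
  elements; the universal property of `A⟦X⟧`).
-/

noncomputable section

universe u

open AlgebraicGeometry CategoryTheory MonObj CartesianMonoidalCategory
open Literature.RingTheory.FormalGroups

namespace Literature.AlgebraicGeometry.GroupSchemes

variable {k : Type u} [CommRing k]

/-! ## §1 Over-morphisms of affine points from algebra maps -/

/-- The `Spec k`-morphism `Spec R′ → Spec R` of a `k`-algebra map `θ : R → R′`. [cite: Tate1967, §2.2] -/
theorem exists_specOver_hom {R R' : Type u} [CommRing R] [Algebra k R] [CommRing R'] [Algebra k R'] (θ : R →ₐ[k] R') :
    ∃ g : specOver (A := k) R' ⟶ specOver (A := k) R, g.left = Spec.map (CommRingCat.ofHom θ.toRingHom) := by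
  refine ⟨Over.homMk (Spec.map (CommRingCat.ofHom θ.toRingHom)) ?_, rfl⟩
  change Spec.map (CommRingCat.ofHom θ.toRingHom) ≫ Spec.map (CommRingCat.ofHom (algebraMap k R)) =
    Spec.map (CommRingCat.ofHom (algebraMap k R'))
  rw [← Spec.map_comp, ← CommRingCat.ofHom_comp, θ.toRingHom_eq_coe, θ.comp_algebraMap]

/-! ## §2 Evaluation at a nilpotent element as an algebra map out of the test algebras `k⟦X⟧⧸(X^N)`, `k⟦X,Y⟧⧸(X^N,Y^N)` -/

/-- **Lift to the test algebra `k⟦X⟧⧸(X^N)`**: for `r ∈ R` with `r^N = 0` there is a `k`-algebra map `θ : k⟦X⟧⧸(X^N) → R` with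
`θ(h̄) = h(r)` (★ `evalNilp`). [cite: BourbakiAlgebraII2003, Ch. IV §4 no. 3] -/
theorem exists_algHom_powerSeriesQuot {R : Type u} [CommRing R] [Algebra k R] {N : ℕ} {r : R} (hr : r ^ N = 0) :
    ∃ θ : (PowerSeries k ⧸ Ideal.span {(PowerSeries.X : PowerSeries k) ^ N}) →ₐ[k] R,
      ∀ h : PowerSeries k, θ (Ideal.Quotient.mk _ h) = evalNilp h r := by
  have hrn : IsNilpotent r := ⟨N, hr⟩
  let Φ : PowerSeries k →ₐ[k] R :=
    { toFun := fun h => evalNilp h r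
      map_one' := evalNilp_one hrn
      map_mul' := fun a b => evalNilp_mul a b r
      map_zero' := evalNilp_zero r
      map_add' := fun a b => evalNilp_add a b r
      commutes' := fun a => by
        show evalNilp (algebraMap k (PowerSeries k) a) r = algebraMap k R a
        rw [PowerSeries.algebraMap_apply, Algebra.algebraMap_self, RingHom.id_apply, evalNilp_C hrn] }
  have hΦ : ∀ a ∈ Ideal.span {(PowerSeries.X : PowerSeries k) ^ N}, Φ a = 0 := by
    intro a ha
    obtain ⟨q, rfl⟩ := Ideal.mem_span_singleton'.mp ha
    show evalNilp (q * PowerSeries.X ^ N) r = 0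
    rw [evalNilp_mul, evalNilp_pow hrn, evalNilp_X hrn, hr, mul_zero]
  exact ⟨Ideal.Quotient.liftₐ _ Φ hΦ, fun h => rfl⟩

/-- **Lift to the test algebra `k⟦X,Y⟧⧸(X^N, Y^N)`**: for `r, s ∈ R` with `r^N = s^N = 0` there is a `k`-algebra map
`θ : k⟦X,Y⟧⧸(X^N,Y^N) → R` with `θ(H̄) = H(r,s)` (★ `evalNilp₂`). [cite: BourbakiAlgebraII2003, Ch. IV §4 no. 3] -/
theorem exists_algHom_mvPowerSeriesQuot {R : Type u} [CommRing R] [Algebra k R] {N : ℕ} {r s : R} (hr : r ^ N = 0)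
    (hs : s ^ N = 0) :
    ∃ θ : (MvPowerSeries (Fin 2) k ⧸
        Ideal.span {(MvPowerSeries.X 0 : MvPowerSeries (Fin 2) k) ^ N, (MvPowerSeries.X 1) ^ N}) →ₐ[k] R,
      ∀ H : MvPowerSeries (Fin 2) k, θ (Ideal.Quotient.mk _ H) = evalNilp₂ H r s := by
  have hrn : IsNilpotent r := ⟨N, hr⟩
  have hsn : IsNilpotent s := ⟨N, hs⟩
  let Φ : MvPowerSeries (Fin 2) k →ₐ[k] R :=
    { toFun := fun H => evalNilp₂ H r s
      map_one' := evalNilp₂_one hrn hsn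
      map_mul' := fun a b => evalNilp₂_mul a b r s
      map_zero' := evalNilp₂_zero r s
      map_add' := fun a b => evalNilp₂_add a b r s
      commutes' := fun a => by
        show evalNilp₂ (algebraMap k (MvPowerSeries (Fin 2) k) a) r s = algebraMap k R a
        rw [MvPowerSeries.algebraMap_apply, Algebra.algebraMap_self, RingHom.id_apply, evalNilp₂_C hrn hsn] }
  have hΦ : ∀ a ∈ Ideal.span {(MvPowerSeries.X 0 : MvPowerSeries (Fin 2) k) ^ N, (MvPowerSeries.X 1) ^ N}, Φ a = 0 := by
    intro a ha
    obtain ⟨q₀, q₁, rfl⟩ := Ideal.mem_span_pair.mp ha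
    show evalNilp₂ (q₀ * MvPowerSeries.X 0 ^ N + q₁ * MvPowerSeries.X 1 ^ N) r s = 0
    rw [evalNilp₂_add, evalNilp₂_mul, evalNilp₂_mul, evalNilp₂_pow hrn hsn, evalNilp₂_pow hrn hsn, evalNilp₂_X₀ hrn hsn,
      evalNilp₂_X₁ hrn hsn, hr, hs, mul_zero, mul_zero, add_zero]
  exact ⟨Ideal.Quotient.liftₐ _ Φ hΦ, fun H => rfl⟩


/-! ## §3 Laws from natural coordinates on the points of a group object over `Spec k` -/

section Laws

variable {G : Over (Spec (.of k))} [GrpObj G] {N : ℕ}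
  (c : ∀ (R : Type u) [CommRing R] [Algebra k R], (specOver (A := k) R ⟶ G) ≃ {x : R // x ^ N = 0})

omit [GrpObj G] in
/-- **Transport of a point along an algebra map**: if `θ : T → R` carries the coordinate of `q ∈ G(T)` to that of `f ∈ G(R)`, then
`f` is the image of `q` under `Spec θ` (naturality + injectivity of the coordinate). [cite: Tate1967, §2.2] -/
theorem exists_comp_eq_of_coord_eq
    (hnat : ∀ (R R' : Type u) [CommRing R] [Algebra k R] [CommRing R'] [Algebra k R'] (φ : R →ₐ[k] R')
      (g : specOver (A := k) R' ⟶ specOver (A := k) R), g.left = Spec.map (CommRingCat.ofHom φ.toRingHom) →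
      ∀ f : specOver (A := k) R ⟶ G, ((c R') (g ≫ f)).1 = φ ((c R) f).1)
    {T R : Type u} [CommRing T] [Algebra k T] [CommRing R] [Algebra k R] (θ : T →ₐ[k] R)
    (q : specOver (A := k) T ⟶ G) (f : specOver (A := k) R ⟶ G) (h : θ ((c T) q).1 = ((c R) f).1) :
    ∃ g : specOver (A := k) R ⟶ specOver (A := k) T, g.left = Spec.map (CommRingCat.ofHom θ.toRingHom) ∧ g ≫ q = f := by
  obtain ⟨g, hg⟩ := exists_specOver_hom θ
  refine ⟨g, hg, (c R).injective (Subtype.ext ?_)⟩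
  rw [hnat T R θ g hg q, h]

omit [GrpObj G] in
/-- **Every morphism `u : G ⟶ G` over `Spec k` acts on points by a power series**: there is `ρ ∈ k⟦X⟧` with
`c (f ≫ u) = ρ(c f)` for all `k`-algebras `R` and all `f ∈ G(R)` (`ρ̄ :=` the coordinate of the image of the universal point
`x̄ ∈ G(k⟦X⟧⧸(X^N))`). [cite: Tate1967, §2.2 (proof of Prop. 1)] -/
theorem exists_series_of_endomorphism
    (hnat : ∀ (R R' : Type u) [CommRing R] [Algebra k R] [CommRing R'] [Algebra k R'] (φ : R →ₐ[k] R')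
      (g : specOver (A := k) R' ⟶ specOver (A := k) R), g.left = Spec.map (CommRingCat.ofHom φ.toRingHom) →
      ∀ f : specOver (A := k) R ⟶ G, ((c R') (g ≫ f)).1 = φ ((c R) f).1)
    (u : G ⟶ G) :
    ∃ ρ : PowerSeries k, ∀ (R : Type u) [CommRing R] [Algebra k R] (f : specOver (A := k) R ⟶ G),
      ((c R) (f ≫ u)).1 = evalNilp ρ ((c R) f).1 := by
  let T := PowerSeries k ⧸ Ideal.span {(PowerSeries.X : PowerSeries k) ^ N}
  let xbar : T := Ideal.Quotient.mk _ PowerSeries.X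
  have hx : xbar ^ N = 0 := mk_X_pow_eq_zero N
  let pt : specOver (A := k) T ⟶ G := (c T).symm ⟨xbar, hx⟩
  have hpt : ((c T) pt).1 = xbar := by simp [pt]
  obtain ⟨ρ, hρ⟩ := Ideal.Quotient.mk_surjective ((c T) (pt ≫ u)).1
  refine ⟨ρ, fun R _ _ f => ?_⟩
  obtain ⟨θ, hθ⟩ := exists_algHom_powerSeriesQuot (k := k) ((c R) f).2
  have hθx : θ ((c T) pt).1 = ((c R) f).1 := by
    rw [hpt, hθ, evalNilp_X ⟨N, ((c R) f).2⟩]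
  obtain ⟨g, hg, hgf⟩ := exists_comp_eq_of_coord_eq c hnat θ pt f hθx
  conv_lhs => rw [← hgf, Category.assoc]
  rw [hnat T R θ g hg (pt ≫ u), ← hρ, hθ]

/-- **The multiplication of `G` acts on points by a two-variable power series**: there is `P ∈ k⟦X,Y⟧` with
`c (f * f′) = P(c f, c f′)` for all `k`-algebras `R` and `f, f′ ∈ G(R)` (`P̄ :=` the coordinate of the product of the two universal
points of `G(k⟦X,Y⟧⧸(X^N,Y^N))`). [cite: Tate1967, §2.2 (proof of Prop. 1)] -/
theorem exists_series_of_mul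
    (hnat : ∀ (R R' : Type u) [CommRing R] [Algebra k R] [CommRing R'] [Algebra k R'] (φ : R →ₐ[k] R')
      (g : specOver (A := k) R' ⟶ specOver (A := k) R), g.left = Spec.map (CommRingCat.ofHom φ.toRingHom) →
      ∀ f : specOver (A := k) R ⟶ G, ((c R') (g ≫ f)).1 = φ ((c R) f).1) :
    ∃ P : MvPowerSeries (Fin 2) k, ∀ (R : Type u) [CommRing R] [Algebra k R] (f f' : specOver (A := k) R ⟶ G),
      ((c R) (f * f')).1 = evalNilp₂ P ((c R) f).1 ((c R) f').1 := by
  let T := MvPowerSeries (Fin 2) k ⧸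
    Ideal.span {(MvPowerSeries.X 0 : MvPowerSeries (Fin 2) k) ^ N, (MvPowerSeries.X 1) ^ N}
  let xbar : Fin 2 → T := fun i => Ideal.Quotient.mk _ (MvPowerSeries.X i)
  have hx : ∀ i, xbar i ^ N = 0 := fun i => mk_X_pow_eq_zero₂ N i
  let pt : Fin 2 → (specOver (A := k) T ⟶ G) := fun i => (c T).symm ⟨xbar i, hx i⟩
  have hpt : ∀ i, ((c T) (pt i)).1 = xbar i := fun i => by simp [pt]
  obtain ⟨P, hP⟩ := Ideal.Quotient.mk_surjective ((c T) (pt 0 * pt 1)).1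
  refine ⟨P, fun R _ _ f f' => ?_⟩
  obtain ⟨θ, hθ⟩ := exists_algHom_mvPowerSeriesQuot (k := k) ((c R) f).2 ((c R) f').2
  have hr : IsNilpotent ((c R) f).1 := ⟨N, ((c R) f).2⟩
  have hs : IsNilpotent ((c R) f').1 := ⟨N, ((c R) f').2⟩
  have hθ0 : θ ((c T) (pt 0)).1 = ((c R) f).1 := by rw [hpt, hθ, evalNilp₂_X₀ hr hs]
  have hθ1 : θ ((c T) (pt 1)).1 = ((c R) f').1 := by rw [hpt, hθ, evalNilp₂_X₁ hr hs]
  obtain ⟨g, hg, hgf⟩ := exists_comp_eq_of_coord_eq c hnat θ (pt 0) f hθ0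
  obtain ⟨g', hg', hgf'⟩ := exists_comp_eq_of_coord_eq c hnat θ (pt 1) f' hθ1
  -- the two transports coincide: both are `Spec θ`
  have hgg : g' = g := Over.OverMorphism.ext (by rw [hg, hg'])
  rw [hgg] at hgf'
  conv_lhs => rw [← hgf, ← hgf', ← MonObj.comp_mul]
  rw [hnat T R θ g hg (pt 0 * pt 1), ← hP, hθ]

/-- **The unit point has coordinate `0`** (over a reduced `k`: the coordinate of `1 ∈ G(k)` is nilpotent, hence `0`, and every
`1 ∈ G(R)` is its image). [cite: Tate1967, §2.2] -/
theorem coord_one_eq_zero [IsReduced k]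
    (hnat : ∀ (R R' : Type u) [CommRing R] [Algebra k R] [CommRing R'] [Algebra k R'] (φ : R →ₐ[k] R')
      (g : specOver (A := k) R' ⟶ specOver (A := k) R), g.left = Spec.map (CommRingCat.ofHom φ.toRingHom) →
      ∀ f : specOver (A := k) R ⟶ G, ((c R') (g ≫ f)).1 = φ ((c R) f).1)
    (R : Type u) [CommRing R] [Algebra k R] : ((c R) (1 : specOver (A := k) R ⟶ G)).1 = 0 := by
  have h0 : ((c k) (1 : specOver (A := k) k ⟶ G)).1 = 0 :=
    IsNilpotent.eq_zero ⟨N, ((c k) (1 : specOver (A := k) k ⟶ G)).2⟩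
  obtain ⟨g, hg⟩ := exists_specOver_hom (Algebra.ofId k R)
  have h := hnat k R (Algebra.ofId k R) g hg 1
  rw [MonObj.comp_one, h0, map_zero] at h
  exact h

/-- **Comparison along a homomorphism**: if `j : G ⟶ G′` is a homomorphism of group objects over `Spec k` compatible with
coordinates `c`, `c′` (`c′ (f ≫ j) = c f`, sizes `N ≤ N′`), then law series `P`, `P′` as in `exists_series_of_mul` AGREE ON THE
BOX `d₀, d₁ < N` (equal values at the universal points of `k⟦X,Y⟧⧸(X^N,Y^N)`, ★ `coeff_eq_of_evalNilp₂_mk_X_eq`).  With `j = 𝟙`: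
the law series is unique below the box; with `j =` a transition map of a `p`-divisible group: box-compatibility of the tower.
[cite: Tate1967, §2.2 (proof of Prop. 1)] -/
theorem coeff_law_eq_of_hom {G' : Over (Spec (.of k))} [GrpObj G'] {N' : ℕ}
    (c' : ∀ (R : Type u) [CommRing R] [Algebra k R], (specOver (A := k) R ⟶ G') ≃ {x : R // x ^ N' = 0})
    (j : G ⟶ G') [IsMonHom j]
    (hj : ∀ (R : Type u) [CommRing R] [Algebra k R] (f : specOver (A := k) R ⟶ G), ((c' R) (f ≫ j)).1 = ((c R) f).1)
    {P P' : MvPowerSeries (Fin 2) k}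
    (hP : ∀ (R : Type u) [CommRing R] [Algebra k R] (f f' : specOver (A := k) R ⟶ G),
      ((c R) (f * f')).1 = evalNilp₂ P ((c R) f).1 ((c R) f').1)
    (hP' : ∀ (R : Type u) [CommRing R] [Algebra k R] (f f' : specOver (A := k) R ⟶ G'),
      ((c' R) (f * f')).1 = evalNilp₂ P' ((c' R) f).1 ((c' R) f').1)
    {d : Fin 2 →₀ ℕ} (h0 : d 0 < N) (h1 : d 1 < N) : MvPowerSeries.coeff d P = MvPowerSeries.coeff d P' := by
  let T := MvPowerSeries (Fin 2) k ⧸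
    Ideal.span {(MvPowerSeries.X 0 : MvPowerSeries (Fin 2) k) ^ N, (MvPowerSeries.X 1) ^ N}
  let xbar : Fin 2 → T := fun i => Ideal.Quotient.mk _ (MvPowerSeries.X i)
  have hx : ∀ i, xbar i ^ N = 0 := fun i => mk_X_pow_eq_zero₂ N i
  let pt : Fin 2 → (specOver (A := k) T ⟶ G) := fun i => (c T).symm ⟨xbar i, hx i⟩
  have hpt : ∀ i, ((c T) (pt i)).1 = xbar i := fun i => by simp [pt]
  refine coeff_eq_of_evalNilp₂_mk_X_eq ?_ h0 h1
  change evalNilp₂ P (xbar 0) (xbar 1) = evalNilp₂ P' (xbar 0) (xbar 1)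
  rw [← hpt 0, ← hpt 1, ← hP, ← hj, MonObj.mul_comp, hP', hj, hj]

omit [GrpObj G] in
/-- The same for endomorphism series along `j` intertwining `u : G ⟶ G` and `u′ : G′ ⟶ G′` (`u ≫ j = j ≫ u′`): `ρ ≡ ρ′` below `N`
(★ `coeff_eq_of_evalNilp_mk_X_eq`). [cite: Tate1967, §2.2 (proof of Prop. 1)] -/
theorem coeff_endo_eq_of_hom {G' : Over (Spec (.of k))} [GrpObj G'] {N' : ℕ}
    (c' : ∀ (R : Type u) [CommRing R] [Algebra k R], (specOver (A := k) R ⟶ G') ≃ {x : R // x ^ N' = 0})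
    (j : G ⟶ G')
    (hj : ∀ (R : Type u) [CommRing R] [Algebra k R] (f : specOver (A := k) R ⟶ G), ((c' R) (f ≫ j)).1 = ((c R) f).1)
    (u : G ⟶ G) (u' : G' ⟶ G') (huu : u ≫ j = j ≫ u') {ρ ρ' : PowerSeries k}
    (hρ : ∀ (R : Type u) [CommRing R] [Algebra k R] (f : specOver (A := k) R ⟶ G), ((c R) (f ≫ u)).1 = evalNilp ρ ((c R) f).1)
    (hρ' : ∀ (R : Type u) [CommRing R] [Algebra k R] (f : specOver (A := k) R ⟶ G'),
      ((c' R) (f ≫ u')).1 = evalNilp ρ' ((c' R) f).1)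
    {m : ℕ} (hm : m < N) : PowerSeries.coeff m ρ = PowerSeries.coeff m ρ' := by
  let T := PowerSeries k ⧸ Ideal.span {(PowerSeries.X : PowerSeries k) ^ N}
  let xbar : T := Ideal.Quotient.mk _ PowerSeries.X
  have hx : xbar ^ N = 0 := mk_X_pow_eq_zero N
  let pt : specOver (A := k) T ⟶ G := (c T).symm ⟨xbar, hx⟩
  have hpt : ((c T) pt).1 = xbar := by simp [pt]
  refine coeff_eq_of_evalNilp_mk_X_eq ?_ hm
  change evalNilp ρ xbar = evalNilp ρ' xbar
  rw [← hpt, ← hρ, ← hj, Category.assoc, huu, ← Category.assoc, hρ', hj]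

end Laws

end Literature.AlgebraicGeometry.GroupSchemes
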